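import Mathlib
import HarnessLib

/-!
# Cauchy's inclusion radius: the positive root of `|aₙ| xⁿ = Σ_{i<n} |aᵢ| xⁱ`

`Literature/Algebra/Polynomial/CauchyRadius.lean` (namespace
`Literature.Algebra.Polynomial.CauchyRadius`; next to `InclusionRadius.lean`). Two definitions
(`cauchyPoly`, `cauchyRadius`) and theorems; everything is PROVED, no named fact.

For a polynomial `p = a₀ + a₁ X + ⋯ + aₙ Xⁿ` (`aₙ ≠ 0`) over a normed division ring, Cauchy's
classical theorem (A.-L. Cauchy 1829) states that every zero `z` satisfies `|z| ≤ ρ`, where `ρ`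
is the unique positive solution of

  `|aₙ| ρⁿ = |a₀| + |a₁| ρ + ⋯ + |aₙ₋₁| ρⁿ⁻¹`

(Henrici, *Applied and Computational Complex Analysis* I, §6.4 **Theorem 6.4l**; Prasolov,
*Polynomials*, §1.1.2 **Theorem 1.1.3 (Cauchy)**: the real polynomial
`xⁿ − b₁xⁿ⁻¹ − ⋯ − bₙ`, `bᵢ ≥ 0` not all zero, "has a unique (simple) positive root `ρ` and the
absolute values of the other roots do not exceed `ρ`"). Among all bounds depending only on the
moduli `|a₀|, …, |aₙ|` this one is best possible: it is attained by the associated real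
polynomial `|aₙ| Xⁿ − Σ_{i<n} |aᵢ| Xⁱ` itself.

We formalise `ρ` order-theoretically, which makes the root bound a one-line consequence of the
triangle inequality and postpones existence/uniqueness questions:

* `cauchyPoly p : ℝ[X]` — the associated real polynomial `|aₙ| Xⁿ − Σ_{i<n} |aᵢ| Xⁱ`;
* `cauchySet p = {x ≥ 0 | cauchyPoly p (x) ≤ 0}` and `cauchyRadius p := sSup (cauchySet p)`.

Main results (`p ≠ 0` throughout, `n := p.natDegree`):

* `norm_mem_cauchySet`, `norm_le_cauchyRadius` — **Cauchy's theorem**: every zero `z` of `p`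
  has `cauchyPoly p (|z|) ≤ 0`, hence `|z| ≤ cauchyRadius p` [Henrici Thm 6.4l; Prasolov Thm 1.1.3];
* `eval_mul_pow_le` / `eval_mul_pow_lt` — monotonicity of `x ↦ cauchyPoly p (x) / xⁿ` on `(0, ∞)`
  (Prasolov's function `−F`), and `eval_pos_of_lt` — positivity beyond any `σ > 0` with
  `cauchyPoly p (σ) ≥ 0`;
* `cauchyRadius_le_of_eval_nonneg` — the CERTIFICATE form used in validated numerics: `σ > 0`,
  `Σ_{i<n} |aᵢ| σⁱ ≤ |aₙ| σⁿ` ⟹ `cauchyRadius p ≤ σ` [Henrici Thm 6.4l as applied]; the resulting zero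
  bound `|z| ≤ σ` is already in the tree as
  `Literature.Algebra.Polynomial.InclusionRadius.norm_le_of_sum_le` and is not restated here;
* `isRoot_cauchyRadius` — for `n ≥ 1`, `ρ = cauchyRadius p` solves Cauchy's equation;
  `eq_cauchyRadius_of_isRoot` — it is the ONLY positive solution; `cauchyRadius_pos` — `ρ > 0` as
  soon as some `aᵢ ≠ 0`, `i < n`; `derivative_eval_pos` — the root is simple
  (`(cauchyPoly p)′(ρ) > 0`) [Prasolov Thm 1.1.3];
* `cauchyRadius_lt_cauchyBound` — `ρ < 1 + max_{i<n} |aᵢ/aₙ|`, i.e. Cauchy's radius refines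
  Mathlib's `Polynomial.cauchyBound`;
* `coeff_cauchyPoly`, `natDegree_cauchyPoly`, `norm_coeff_cauchyPoly`, `cauchyPoly_cauchyPoly`,
  `cauchyRadius_cauchyPoly`, `exists_sameModuli_isRoot` — OPTIMALITY: `cauchyPoly p` has the same
  degree and coefficient moduli as `p` and has the zero `ρ` of modulus `ρ` [Prasolov §1.1.2, remark
  after Thm 1.1.3; Henrici §6.4.III].

Deviations from the sources: ascending coefficients `aᵢ = p.coeff i` (Mathlib) instead of
Prasolov's descending `bᵢ`; `ρ` is DEFINED as a supremum (for `n = 0` the set is empty and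
`ρ = 0`, consistent with a non-zero constant having no zeros; for `p = aₙ Xⁿ` one gets `ρ = 0`);
the normed division ring generality follows Mathlib's `cauchyBound`. Ostrovsky's strict
refinement (Prasolov Thm 1.1.4) is not formalised.

References: Henrici1974 = P. Henrici, *Applied and Computational Complex Analysis*, vol. 1,
Wiley 1974, §6.4 Thm 6.4l (p. 458); Prasolov2004 = V. V. Prasolov, *Polynomials*, Springer
2004, §1.1.2 Thm 1.1.3.
-/

noncomputable section

open Polynomial Finset Set Filter Topology NNReal

namespace Literature.Algebra.Polynomial.CauchyRadius

variable {K : Type*} [NormedDivisionRing K]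

/-! ### The associated real polynomial and the Cauchy set -/

/-- Cauchy's associated real polynomial `|aₙ| Xⁿ − Σ_{i<n} |aᵢ| Xⁱ` of `p = Σ aᵢ Xⁱ`
(`n = natDegree p`, `aₙ = leadingCoeff p`). [cite: Henrici1974, §6.4 Thm 6.4l; Prasolov2004,
§1.1.2 Thm 1.1.3] -/
def cauchyPoly (p : K[X]) : ℝ[X] :=
  C ‖p.leadingCoeff‖ * X ^ p.natDegree - ∑ i ∈ range p.natDegree, C ‖p.coeff i‖ * X ^ i

/-- Evaluation of `cauchyPoly p`: `|aₙ| xⁿ − Σ_{i<n} |aᵢ| xⁱ`. [folklore] -/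
private theorem eval_cauchyPoly (p : K[X]) (x : ℝ) :
    (cauchyPoly p).eval x =
      ‖p.leadingCoeff‖ * x ^ p.natDegree - ∑ i ∈ range p.natDegree, ‖p.coeff i‖ * x ^ i := by
  simp [cauchyPoly, eval_finsetSum]

/-- The coefficients of `cauchyPoly p`: `|aₙ|` in degree `n`, `−|aᵢ|` in degree `i < n`, `0` above.
[folklore] -/
private theorem coeff_cauchyPoly (p : K[X]) (i : ℕ) :
    (cauchyPoly p).coeff i =
      if i = p.natDegree then ‖p.leadingCoeff‖ else if i < p.natDegree then -‖p.coeff i‖ else 0 := by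
  simp only [cauchyPoly, coeff_sub, coeff_C_mul_X_pow, finsetSum_coeff]
  rw [Finset.sum_ite_eq]
  simp only [Finset.mem_range]
  split_ifs with h1 h2 h3 <;> first | omega | simp

/-- The coefficient moduli of `cauchyPoly p` agree with those of `p`. [folklore] -/
private theorem norm_coeff_cauchyPoly (p : K[X]) (i : ℕ) : ‖(cauchyPoly p).coeff i‖ = ‖p.coeff i‖ := by
  rw [coeff_cauchyPoly]
  split_ifs with h1 h2
  · rw [h1, coeff_natDegree]; simp
  · simp
  · have : p.coeff i = 0 := coeff_eq_zero_of_natDegree_lt (by omega)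
    simp [this]

/-- `cauchyPoly p` has the same degree as `p` (for `p ≠ 0`). [folklore] -/
private theorem natDegree_cauchyPoly {p : K[X]} (hp : p ≠ 0) : (cauchyPoly p).natDegree = p.natDegree := by
  have hlc : ‖p.leadingCoeff‖ ≠ 0 := norm_ne_zero_iff.mpr (leadingCoeff_ne_zero.mpr hp)
  rcases Nat.eq_zero_or_pos p.natDegree with hn | hn
  · simp [cauchyPoly, hn]
  · unfold cauchyPoly
    rw [natDegree_sub_eq_left_of_natDegree_lt]
    · exact natDegree_C_mul_X_pow _ _ hlc
    · rw [natDegree_C_mul_X_pow _ _ hlc]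
      refine lt_of_le_of_lt (natDegree_sum_le_of_forall_le (n := p.natDegree - 1) _ _ ?_) (by omega)
      intro i hi
      exact (natDegree_C_mul_X_pow_le _ _).trans (by have := Finset.mem_range.mp hi; omega)

/-- The leading coefficient of `cauchyPoly p` is `|aₙ|`. [folklore] -/
private theorem leadingCoeff_cauchyPoly {p : K[X]} (hp : p ≠ 0) :
    (cauchyPoly p).leadingCoeff = ‖p.leadingCoeff‖ := by
  rw [leadingCoeff, natDegree_cauchyPoly hp, coeff_cauchyPoly, if_pos rfl]

/-- The Cauchy set `{x ≥ 0 : |aₙ| xⁿ ≤ Σ_{i<n} |aᵢ| xⁱ}`; it turns out to be the interval `[0, ρ]`.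
[folklore] -/
def cauchySet (p : K[X]) : Set ℝ := {x | 0 ≤ x ∧ (cauchyPoly p).eval x ≤ 0}

/-- **Cauchy's inclusion radius** `ρ(p) := sup {x ≥ 0 : |aₙ| xⁿ ≤ Σ_{i<n} |aᵢ| xⁱ}`; for
`n ≥ 1` this is the unique positive root of `cauchyPoly p` (`isRoot_cauchyRadius`,
`eq_cauchyRadius_of_isRoot`). [cite: Henrici1974, §6.4 Thm 6.4l; Prasolov2004, §1.1.2 Thm 1.1.3] -/
def cauchyRadius (p : K[X]) : ℝ := sSup (cauchySet p)

/-! ### Cauchy's theorem: the modulus of every zero lies in the Cauchy set -/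

/-- The modulus of a zero of `p ≠ 0` satisfies `|aₙ| |z|ⁿ ≤ Σ_{i<n} |aᵢ| |z|ⁱ` (triangle inequality
applied to `aₙ zⁿ = −Σ_{i<n} aᵢ zⁱ`). [cite: Prasolov2004, §1.1.2 Thm 1.1.3 (proof)] -/
theorem norm_mem_cauchySet {p : K[X]} (hp : p ≠ 0) {z : K} (hz : p.IsRoot z) :
    ‖z‖ ∈ cauchySet p := by
  have _ := hp
  refine ⟨norm_nonneg z, ?_⟩
  rw [eval_cauchyPoly, sub_nonpos]
  have h := hz
  rw [IsRoot.def, eval_eq_sum_range, sum_range_succ, coeff_natDegree] at h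
  have h2 : p.leadingCoeff * z ^ p.natDegree = -∑ i ∈ range p.natDegree, p.coeff i * z ^ i :=
    eq_neg_of_add_eq_zero_right h
  calc ‖p.leadingCoeff‖ * ‖z‖ ^ p.natDegree = ‖p.leadingCoeff * z ^ p.natDegree‖ := by
        rw [norm_mul, norm_pow]
    _ = ‖∑ i ∈ range p.natDegree, p.coeff i * z ^ i‖ := by rw [h2, norm_neg]
    _ ≤ ∑ i ∈ range p.natDegree, ‖p.coeff i * z ^ i‖ := norm_sum_le _ _
    _ = ∑ i ∈ range p.natDegree, ‖p.coeff i‖ * ‖z‖ ^ i := by simp [norm_pow]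

/-! ### Monotonicity of `cauchyPoly p (x) / xⁿ` -/

/-- `yⁱ xⁿ ≤ xⁱ yⁿ` for `0 ≤ x ≤ y` and `i ≤ n`. [folklore] -/
private theorem pow_mul_pow_le {x y : ℝ} (hx : 0 ≤ x) (hxy : x ≤ y) {i n : ℕ} (hi : i ≤ n) :
    y ^ i * x ^ n ≤ x ^ i * y ^ n := by
  obtain ⟨m, rfl⟩ := Nat.exists_eq_add_of_le hi
  rw [pow_add, pow_add]
  have hm := pow_le_pow_left₀ hx hxy m
  have hxi := pow_nonneg hx i
  have hyi := pow_nonneg (hx.trans hxy) i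
  nlinarith [mul_nonneg hxi hyi]

/-- `yⁱ xⁿ < xⁱ yⁿ` for `0 < x < y` and `i < n`. [folklore] -/
private theorem pow_mul_pow_lt {x y : ℝ} (hx : 0 < x) (hxy : x < y) {i n : ℕ} (hi : i < n) :
    y ^ i * x ^ n < x ^ i * y ^ n := by
  obtain ⟨m, rfl⟩ := Nat.exists_eq_add_of_le hi.le
  rw [pow_add, pow_add]
  have hm : x ^ m < y ^ m := pow_lt_pow_left₀ hxy hx.le (by omega)
  have hxi := pow_pos hx i
  have hyi := pow_pos (hx.trans hxy) i
  nlinarith [mul_pos hxi hyi]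

/-- Monotonicity (Prasolov's `F(x) = Σ bᵢ x⁻ⁱ − 1` is decreasing): for `0 < x ≤ y`,
`cauchyPoly p (x) · yⁿ ≤ cauchyPoly p (y) · xⁿ`. [cite: Prasolov2004, §1.1.2 Thm 1.1.3 (proof)] -/
theorem eval_mul_pow_le (p : K[X]) {x y : ℝ} (hx : 0 < x) (hxy : x ≤ y) :
    (cauchyPoly p).eval x * y ^ p.natDegree ≤ (cauchyPoly p).eval y * x ^ p.natDegree := by
  rw [eval_cauchyPoly, eval_cauchyPoly, sub_mul, sub_mul, sum_mul, sum_mul]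
  have key : ∑ i ∈ range p.natDegree, ‖p.coeff i‖ * y ^ i * x ^ p.natDegree ≤
      ∑ i ∈ range p.natDegree, ‖p.coeff i‖ * x ^ i * y ^ p.natDegree := by
    refine sum_le_sum fun i hi => ?_
    rw [mul_assoc, mul_assoc]
    exact mul_le_mul_of_nonneg_left (pow_mul_pow_le hx.le hxy (Finset.mem_range.mp hi).le)
      (norm_nonneg _)
  have e : ‖p.leadingCoeff‖ * x ^ p.natDegree * y ^ p.natDegree =
      ‖p.leadingCoeff‖ * y ^ p.natDegree * x ^ p.natDegree := by ring
  linarith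

/-- Strict monotonicity when some lower coefficient is non-zero: for `0 < x < y`,
`cauchyPoly p (x) · yⁿ < cauchyPoly p (y) · xⁿ`. [cite: Prasolov2004, §1.1.2 Thm 1.1.3 (proof)] -/
theorem eval_mul_pow_lt {p : K[X]} (hi : ∃ i < p.natDegree, p.coeff i ≠ 0) {x y : ℝ}
    (hx : 0 < x) (hxy : x < y) :
    (cauchyPoly p).eval x * y ^ p.natDegree < (cauchyPoly p).eval y * x ^ p.natDegree := by
  obtain ⟨i₀, hi₀, hne⟩ := hi
  rw [eval_cauchyPoly, eval_cauchyPoly, sub_mul, sub_mul, sum_mul, sum_mul]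
  have key : ∑ i ∈ range p.natDegree, ‖p.coeff i‖ * y ^ i * x ^ p.natDegree <
      ∑ i ∈ range p.natDegree, ‖p.coeff i‖ * x ^ i * y ^ p.natDegree := by
    refine sum_lt_sum (fun i hi => ?_) ⟨i₀, Finset.mem_range.mpr hi₀, ?_⟩
    · rw [mul_assoc, mul_assoc]
      exact mul_le_mul_of_nonneg_left (pow_mul_pow_le hx.le hxy.le (Finset.mem_range.mp hi).le)
        (norm_nonneg _)
    · rw [mul_assoc, mul_assoc]
      exact mul_lt_mul_of_pos_left (pow_mul_pow_lt hx hxy hi₀) (norm_pos_iff.mpr hne)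
  have e : ‖p.leadingCoeff‖ * x ^ p.natDegree * y ^ p.natDegree =
      ‖p.leadingCoeff‖ * y ^ p.natDegree * x ^ p.natDegree := by ring
  linarith

/-- Beyond a point `σ > 0` with `cauchyPoly p (σ) ≥ 0` the associated polynomial is POSITIVE:
`σ < y ⟹ cauchyPoly p (y) > 0` (for `p ≠ 0`). [cite: Prasolov2004, §1.1.2 Thm 1.1.3 (proof)] -/
theorem eval_pos_of_lt {p : K[X]} (hp : p ≠ 0) {σ y : ℝ} (hσ : 0 < σ) (hσy : σ < y)
    (h : 0 ≤ (cauchyPoly p).eval σ) : 0 < (cauchyPoly p).eval y := by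
  have hy : 0 < y := hσ.trans hσy
  by_cases hi : ∃ i < p.natDegree, p.coeff i ≠ 0
  · have hlt := eval_mul_pow_lt hi hσ hσy
    have h1 : 0 ≤ (cauchyPoly p).eval σ * y ^ p.natDegree := mul_nonneg h (pow_nonneg hy.le _)
    have h2 : 0 < (cauchyPoly p).eval y * σ ^ p.natDegree := lt_of_le_of_lt h1 hlt
    exact pos_of_mul_pos_left h2 (pow_nonneg hσ.le _)
  · push Not at hi
    have hsum : ∑ i ∈ range p.natDegree, ‖p.coeff i‖ * y ^ i = 0 :=
      sum_eq_zero fun i hi' => by rw [hi i (Finset.mem_range.mp hi'), norm_zero, zero_mul]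
    rw [eval_cauchyPoly, hsum, sub_zero]
    exact mul_pos (norm_pos_iff.mpr (leadingCoeff_ne_zero.mpr hp)) (pow_pos hy _)

/-! ### Comparison with Mathlib's `cauchyBound` and boundedness of the Cauchy set -/

/-- At Mathlib's Cauchy bound `σ = 1 + max_{i<n} |aᵢ|/|aₙ|` the associated polynomial is at least
`|aₙ| > 0`: `|aₙ| σⁿ − Σ |aᵢ| σⁱ ≥ |aₙ| σⁿ − |aₙ|(σ − 1) Σ σⁱ = |aₙ|`. [folklore] -/
private theorem norm_leadingCoeff_le_eval_cauchyBound (p : K[X]) :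
    ‖p.leadingCoeff‖ ≤ (cauchyPoly p).eval (p.cauchyBound : ℝ) := by
  rcases eq_or_ne p 0 with rfl | hp
  · simp [cauchyPoly]
  have ha : 0 < ‖p.leadingCoeff‖ := norm_pos_iff.mpr (leadingCoeff_ne_zero.mpr hp)
  set σ : ℝ := (p.cauchyBound : ℝ) with hσdef
  have hσ1 : σ - 1 =
      (((range p.natDegree).sup fun i => ‖p.coeff i‖₊ : ℝ≥0) : ℝ) / ‖p.leadingCoeff‖ := by
    simp [hσdef, Polynomial.cauchyBound]
  have hB : ∀ i ∈ range p.natDegree, ‖p.coeff i‖ ≤ ‖p.leadingCoeff‖ * (σ - 1) := by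
    intro i hi
    have hle : ‖p.coeff i‖ ≤ (((range p.natDegree).sup fun i => ‖p.coeff i‖₊ : ℝ≥0) : ℝ) := by
      have := Finset.le_sup (f := fun i => ‖p.coeff i‖₊) hi
      exact_mod_cast this
    rw [hσ1, mul_div_cancel₀ _ ha.ne']
    exact hle
  have hσ0 : 0 ≤ σ := by positivity
  have hsum : ∑ i ∈ range p.natDegree, ‖p.coeff i‖ * σ ^ i ≤
      ‖p.leadingCoeff‖ * (σ - 1) * ∑ i ∈ range p.natDegree, σ ^ i := by
    rw [mul_sum]
    exact sum_le_sum fun i hi => mul_le_mul_of_nonneg_right (hB i hi) (pow_nonneg hσ0 i)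
  have hgeom : ‖p.leadingCoeff‖ * (σ - 1) * ∑ i ∈ range p.natDegree, σ ^ i =
      ‖p.leadingCoeff‖ * (σ ^ p.natDegree - 1) := by
    rw [mul_assoc, mul_comm (σ - 1), geom_sum_mul]
  rw [eval_cauchyPoly]
  linarith

/-- The Cauchy set lies in `[0, cauchyBound p]` (for `p ≠ 0`). [folklore] -/
private theorem cauchySet_subset_Icc {p : K[X]} (hp : p ≠ 0) :
    cauchySet p ⊆ Icc 0 (p.cauchyBound : ℝ) := by
  intro x hx
  refine ⟨hx.1, ?_⟩
  by_contra hlt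
  push Not at hlt
  have hσ : (0 : ℝ) < p.cauchyBound := by
    have := p.one_le_cauchyBound
    exact_mod_cast zero_lt_one.trans_le this
  have := eval_pos_of_lt hp hσ hlt
    ((norm_nonneg _).trans (norm_leadingCoeff_le_eval_cauchyBound p))
  linarith [hx.2]

/-- The Cauchy set is bounded above. [folklore] -/
private theorem bddAbove_cauchySet {p : K[X]} (hp : p ≠ 0) : BddAbove (cauchySet p) :=
  (bddAbove_Icc).mono (cauchySet_subset_Icc hp)

/-- The Cauchy set is closed. [folklore] -/
private theorem isClosed_cauchySet (p : K[X]) : IsClosed (cauchySet p) :=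
  isClosed_Ici.inter (isClosed_Iic.preimage (cauchyPoly p).continuous)

/-- `0 ≤ cauchyRadius p`. [cite: Henrici1974, §6.4 Thm 6.4l (the Cauchy radius ρ: unique positive zero of
the associated polynomial) — elementary property, folklore] -/
theorem cauchyRadius_nonneg (p : K[X]) : 0 ≤ cauchyRadius p :=
  Real.sSup_nonneg fun _ hx => hx.1

/-- `cauchyRadius p ≤ cauchyBound p`. [cite: Prasolov2004, §1.1.2 (Cauchy's two bounds: ρ versus 1 + max
|aᵢ/aₙ|) — comparison remark, folklore] -/
theorem cauchyRadius_le_cauchyBound {p : K[X]} (hp : p ≠ 0) :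
    cauchyRadius p ≤ (p.cauchyBound : ℝ) :=
  Real.sSup_le (fun _ hx => (cauchySet_subset_Icc hp hx).2) (by positivity)

/-! ### The root bound and the certificate form -/

/-- **Cauchy's theorem** (Henrici Thm 6.4l; Prasolov Thm 1.1.3): every zero `z` of `p ≠ 0`
satisfies `|z| ≤ cauchyRadius p`. [cite: Henrici1974, §6.4 Thm 6.4l; Prasolov2004, §1.1.2
Thm 1.1.3] -/
theorem norm_le_cauchyRadius {p : K[X]} (hp : p ≠ 0) {z : K} (hz : p.IsRoot z) :
    ‖z‖ ≤ cauchyRadius p :=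
  le_csSup (bddAbove_cauchySet hp) (norm_mem_cauchySet hp hz)

/-- **Certificate form**: if `σ > 0` and `cauchyPoly p (σ) ≥ 0`, i.e.
`Σ_{i<n} |aᵢ| σⁱ ≤ |aₙ| σⁿ`, then `cauchyRadius p ≤ σ`. [cite: Henrici1974, §6.4 Thm 6.4l;
Prasolov2004, §1.1.2 Thm 1.1.3 (proof)] -/
theorem cauchyRadius_le_of_eval_nonneg {p : K[X]} (hp : p ≠ 0) {σ : ℝ} (hσ : 0 < σ)
    (h : 0 ≤ (cauchyPoly p).eval σ) : cauchyRadius p ≤ σ := by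
  refine Real.sSup_le (fun x hx => ?_) hσ.le
  by_contra hlt
  push Not at hlt
  have := eval_pos_of_lt hp hσ hlt h
  linarith [hx.2]

/-! ### `ρ` is the unique positive root of the associated polynomial -/

/-- For `n ≥ 1`: `cauchyPoly p (0) = −|a₀| ≤ 0`, so `0 ∈ cauchySet p`. [folklore] -/
private theorem eval_zero_cauchyPoly {p : K[X]} (hn : 0 < p.natDegree) :
    (cauchyPoly p).eval 0 = -‖p.coeff 0‖ := by
  rw [eval_cauchyPoly, zero_pow hn.ne', mul_zero, zero_sub,
    Finset.sum_eq_single 0 (fun i _ hi => by simp [hi]) (fun h => absurd (Finset.mem_range.mpr hn) h)]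
  simp

/-- `0 ∈ cauchySet p` for `n ≥ 1`. [folklore] -/
private theorem zero_mem_cauchySet {p : K[X]} (hn : 0 < p.natDegree) : (0 : ℝ) ∈ cauchySet p :=
  ⟨le_rfl, by rw [eval_zero_cauchyPoly hn]; exact neg_nonpos.mpr (norm_nonneg _)⟩

/-- `ρ ∈ cauchySet p` for `n ≥ 1` (closed, non-empty, bounded). [cite: Henrici1974, §6.4 Thm 6.4l (the
Cauchy radius ρ: unique positive zero of the associated polynomial) — elementary property, folklore] -/
theorem cauchyRadius_mem_cauchySet {p : K[X]} (hp : p ≠ 0) (hn : 0 < p.natDegree) :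
    cauchyRadius p ∈ cauchySet p :=
  (isClosed_cauchySet p).csSup_mem ⟨0, zero_mem_cauchySet hn⟩ (bddAbove_cauchySet hp)

/-- **Existence** (Prasolov Thm 1.1.3, Henrici Thm 6.4l: "the positive solution"): for `n ≥ 1`,
`ρ = cauchyRadius p` solves Cauchy's equation `|aₙ| ρⁿ = Σ_{i<n} |aᵢ| ρⁱ`.
[cite: Prasolov2004, §1.1.2 Thm 1.1.3; Henrici1974, §6.4 Thm 6.4l] -/
theorem isRoot_cauchyRadius {p : K[X]} (hp : p ≠ 0) (hn : 0 < p.natDegree) :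
    (cauchyPoly p).IsRoot (cauchyRadius p) := by
  have hmem := cauchyRadius_mem_cauchySet hp hn
  refine le_antisymm hmem.2 ?_
  by_contra hneg
  push Not at hneg
  have hev : ∀ᶠ x in 𝓝 (cauchyRadius p), (cauchyPoly p).eval x < 0 :=
    ((cauchyPoly p).continuous.tendsto _).eventually_lt_const hneg
  obtain ⟨ε, hε, hball⟩ := Metric.eventually_nhds_iff.mp hev
  have hx : cauchyRadius p + ε / 2 ∈ cauchySet p := by
    refine ⟨by linarith [cauchyRadius_nonneg p], (hball ?_).le⟩
    rw [Real.dist_eq, add_sub_cancel_left, abs_of_pos (by linarith)]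
    linarith
  have : cauchyRadius p + ε / 2 ≤ cauchyRadius p := le_csSup (bddAbove_cauchySet hp) hx
  linarith

/-- Cauchy's equation in expanded form at `ρ`: `|aₙ| ρⁿ = Σ_{i<n} |aᵢ| ρⁱ` (`n ≥ 1`).
[cite: Henrici1974, §6.4 Thm 6.4l] -/
theorem cauchyRadius_eq {p : K[X]} (hp : p ≠ 0) (hn : 0 < p.natDegree) :
    ‖p.leadingCoeff‖ * cauchyRadius p ^ p.natDegree =
      ∑ i ∈ range p.natDegree, ‖p.coeff i‖ * cauchyRadius p ^ i := by
  have h := isRoot_cauchyRadius hp hn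
  rw [IsRoot.def, eval_cauchyPoly] at h
  linarith

/-- **Uniqueness** (Prasolov Thm 1.1.3: "a unique positive root"): a positive root of
`cauchyPoly p` equals `cauchyRadius p` (`p ≠ 0`). [cite: Prasolov2004, §1.1.2 Thm 1.1.3] -/
theorem eq_cauchyRadius_of_isRoot {p : K[X]} (hp : p ≠ 0) {x : ℝ} (hx : 0 < x)
    (hx0 : (cauchyPoly p).IsRoot x) : x = cauchyRadius p := by
  rcases Nat.eq_zero_or_pos p.natDegree with hn | hn
  · exfalso
    rw [IsRoot.def, eval_cauchyPoly, hn] at hx0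
    simp only [pow_zero, mul_one, range_zero, sum_empty, sub_zero, norm_eq_zero,
      leadingCoeff_eq_zero] at hx0
    exact hp hx0
  have hxS : x ∈ cauchySet p := ⟨hx.le, le_of_eq hx0⟩
  have hle : x ≤ cauchyRadius p := le_csSup (bddAbove_cauchySet hp) hxS
  rcases hle.eq_or_lt with h | h
  · exact h
  · exfalso
    have hpos := eval_pos_of_lt hp hx h (le_of_eq hx0.symm)
    have := isRoot_cauchyRadius hp hn
    rw [IsRoot.def] at this
    linarith

/-- Two positive roots of `cauchyPoly p` coincide (`p ≠ 0`). [cite: Prasolov2004, §1.1.2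
Thm 1.1.3] -/
theorem eq_of_isRoot_of_isRoot {p : K[X]} (hp : p ≠ 0) {x y : ℝ} (hx : 0 < x) (hy : 0 < y)
    (hx0 : (cauchyPoly p).IsRoot x) (hy0 : (cauchyPoly p).IsRoot y) : x = y := by
  rw [eq_cauchyRadius_of_isRoot hp hx hx0, eq_cauchyRadius_of_isRoot hp hy hy0]

/-- **Positivity**: if some lower coefficient `aᵢ ≠ 0` (`i < n`) then `ρ > 0`; indeed
`x₀ := min 1 (|aᵢ| / (2|aₙ|))` already lies in the Cauchy set. [cite: Prasolov2004, §1.1.2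
Thm 1.1.3] -/
theorem cauchyRadius_pos {p : K[X]} (hp : p ≠ 0) (hi : ∃ i < p.natDegree, p.coeff i ≠ 0) :
    0 < cauchyRadius p := by
  obtain ⟨i, hi, hne⟩ := hi
  have ha : 0 < ‖p.leadingCoeff‖ := norm_pos_iff.mpr (leadingCoeff_ne_zero.mpr hp)
  have hai : 0 < ‖p.coeff i‖ := norm_pos_iff.mpr hne
  set x₀ : ℝ := min 1 (‖p.coeff i‖ / (2 * ‖p.leadingCoeff‖)) with hx₀
  have hx0 : 0 < x₀ := lt_min one_pos (by positivity)
  have hx1 : x₀ ≤ 1 := min_le_left _ _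
  have h3 : ‖p.leadingCoeff‖ * x₀ ≤ ‖p.coeff i‖ / 2 := by
    calc ‖p.leadingCoeff‖ * x₀ ≤ ‖p.leadingCoeff‖ * (‖p.coeff i‖ / (2 * ‖p.leadingCoeff‖)) :=
          mul_le_mul_of_nonneg_left (min_le_right _ _) ha.le
      _ = ‖p.coeff i‖ / 2 := by field_simp
  have h1 : ‖p.coeff i‖ * x₀ ^ i ≤ ∑ j ∈ range p.natDegree, ‖p.coeff j‖ * x₀ ^ j :=
    single_le_sum (f := fun j => ‖p.coeff j‖ * x₀ ^ j) (fun j _ => by positivity)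
      (Finset.mem_range.mpr hi)
  have h2 : x₀ ^ p.natDegree ≤ x₀ ^ (i + 1) := pow_le_pow_of_le_one hx0.le hx1 (by omega)
  have hxi : 0 < x₀ ^ i := pow_pos hx0 i
  have hmem : x₀ ∈ cauchySet p := by
    refine ⟨hx0.le, ?_⟩
    rw [eval_cauchyPoly, sub_nonpos]
    calc ‖p.leadingCoeff‖ * x₀ ^ p.natDegree ≤ ‖p.leadingCoeff‖ * x₀ ^ (i + 1) :=
          mul_le_mul_of_nonneg_left h2 ha.le
      _ = ‖p.leadingCoeff‖ * x₀ * x₀ ^ i := by ring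
      _ ≤ ‖p.coeff i‖ / 2 * x₀ ^ i := mul_le_mul_of_nonneg_right h3 hxi.le
      _ ≤ ‖p.coeff i‖ * x₀ ^ i := by nlinarith
      _ ≤ _ := h1
  exact lt_of_lt_of_le hx0 (le_csSup (bddAbove_cauchySet hp) hmem)

/-- If all lower coefficients vanish (`p = aₙ Xⁿ`, `n ≥ 1`) then `ρ = 0`. [cite: Henrici1974, §6.4 Thm 6.4l
(the Cauchy radius ρ: unique positive zero of the associated polynomial) — elementary property, folklore] -/
theorem cauchyRadius_eq_zero {p : K[X]} (hp : p ≠ 0) (hn : 0 < p.natDegree)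
    (h : ∀ i < p.natDegree, p.coeff i = 0) : cauchyRadius p = 0 := by
  have ha : 0 < ‖p.leadingCoeff‖ := norm_pos_iff.mpr (leadingCoeff_ne_zero.mpr hp)
  have hS : cauchySet p = {0} := by
    ext x
    simp only [cauchySet, mem_setOf_eq, mem_singleton_iff, eval_cauchyPoly]
    have hsum : ∑ i ∈ range p.natDegree, ‖p.coeff i‖ * x ^ i = 0 :=
      sum_eq_zero fun i hi => by rw [h i (Finset.mem_range.mp hi), norm_zero, zero_mul]
    rw [hsum, sub_zero]
    constructor
    · rintro ⟨h0, hle⟩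
      have : x ^ p.natDegree ≤ 0 := by
        by_contra hc
        push Not at hc
        linarith [mul_pos ha hc]
      have hx : x ^ p.natDegree = 0 := le_antisymm this (pow_nonneg h0 _)
      exact pow_eq_zero_iff hn.ne' |>.mp hx
    · rintro rfl
      simp [zero_pow hn.ne']
  rw [cauchyRadius, hS, csSup_singleton]

/-- **Simplicity of the root** (Prasolov Thm 1.1.3: "unique (simple) positive root"): at a positive
root `x` of `cauchyPoly p` one has `x · (cauchyPoly p)′(x) = Σ_{i<n} (n − i)|aᵢ| xⁱ > 0` provided
some `aᵢ ≠ 0`; hence `(cauchyPoly p)′(x) > 0`. [cite: Prasolov2004, §1.1.2 Thm 1.1.3] -/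
theorem derivative_eval_pos {p : K[X]} (hi : ∃ i < p.natDegree, p.coeff i ≠ 0)
    {x : ℝ} (hx : 0 < x) (hx0 : (cauchyPoly p).IsRoot x) :
    0 < (cauchyPoly p).derivative.eval x := by
  obtain ⟨i₀, hi₀, hne⟩ := hi
  have hroot : ‖p.leadingCoeff‖ * x ^ p.natDegree =
      ∑ i ∈ range p.natDegree, ‖p.coeff i‖ * x ^ i := by
    have h := hx0
    rw [IsRoot.def, eval_cauchyPoly] at h
    linarith
  -- the derivative, evaluated and multiplied by `x`
  have hterm : ∀ (c : ℝ) (k : ℕ),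
      x * (derivative (C c * X ^ k)).eval x = (k : ℝ) * (c * x ^ k) := by
    intro c k
    rw [derivative_C_mul_X_pow, eval_mul, eval_C, eval_pow, eval_X]
    rcases k with _ | k
    · simp
    · rw [Nat.add_sub_cancel, pow_succ]
      push_cast
      ring
  have hder : x * (cauchyPoly p).derivative.eval x =
      (p.natDegree : ℝ) * (‖p.leadingCoeff‖ * x ^ p.natDegree) -
        ∑ i ∈ range p.natDegree, (i : ℝ) * (‖p.coeff i‖ * x ^ i) := by
    simp only [cauchyPoly, derivative_sub, derivative_sum, eval_sub, eval_finsetSum, mul_sub,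
      mul_sum, hterm]
  have hsum_lt : ∑ i ∈ range p.natDegree, (i : ℝ) * (‖p.coeff i‖ * x ^ i) <
      ∑ i ∈ range p.natDegree, (p.natDegree : ℝ) * (‖p.coeff i‖ * x ^ i) := by
    refine sum_lt_sum (fun i hi => ?_) ⟨i₀, Finset.mem_range.mpr hi₀, ?_⟩
    · exact mul_le_mul_of_nonneg_right (by exact_mod_cast (Finset.mem_range.mp hi).le)
        (by positivity)
    · exact mul_lt_mul_of_pos_right (by exact_mod_cast hi₀)
        (mul_pos (norm_pos_iff.mpr hne) (pow_pos hx _))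
  have hpos : 0 < x * (cauchyPoly p).derivative.eval x := by
    rw [hder, hroot, mul_sum]
    linarith
  exact pos_of_mul_pos_right hpos hx.le

/-- **Refinement of Mathlib's bound**: `cauchyRadius p < cauchyBound p = 1 + max_{i<n} |aᵢ/aₙ|`
(`p ≠ 0`). [cite: Prasolov2004, §1.1.2 (Cauchy's two bounds: ρ versus 1 + max |aᵢ/aₙ|) — strict comparison,
folklore refinement] -/
theorem cauchyRadius_lt_cauchyBound {p : K[X]} (hp : p ≠ 0) :
    cauchyRadius p < (p.cauchyBound : ℝ) := by
  have ha : 0 < ‖p.leadingCoeff‖ := norm_pos_iff.mpr (leadingCoeff_ne_zero.mpr hp)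
  have hle := cauchyRadius_le_cauchyBound hp
  refine lt_of_le_of_ne hle fun heq => ?_
  rcases Nat.eq_zero_or_pos p.natDegree with hn | hn
  · -- constant non-zero polynomial: the Cauchy set is empty and `ρ = 0 < 1 ≤ cauchyBound`
    have hS : cauchySet p = ∅ := by
      ext x
      simp only [cauchySet, mem_setOf_eq, mem_empty_iff_false, iff_false, not_and, not_le,
        eval_cauchyPoly, hn, pow_zero, mul_one, range_zero, sum_empty, sub_zero]
      exact fun _ => ha
    have h0 : cauchyRadius p = 0 := by rw [cauchyRadius, hS, Real.sSup_empty]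
    have h1 : (1 : ℝ) ≤ p.cauchyBound := by exact_mod_cast p.one_le_cauchyBound
    linarith
  · have hmem := cauchyRadius_mem_cauchySet hp hn
    have hpos := ha.trans_le (norm_leadingCoeff_le_eval_cauchyBound p)
    rw [← heq] at hpos
    linarith [hmem.2]

/-! ### Optimality: the bound is attained within the class of equal coefficient moduli -/

/-- The associated polynomial is idempotent: `cauchyPoly (cauchyPoly p) = cauchyPoly p`
(`p ≠ 0`). [cite: Henrici1974, §6.4 Thm 6.4l (the Cauchy radius ρ: unique positive zero of the associated
polynomial) — idempotence remark, folklore] -/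
theorem cauchyPoly_cauchyPoly {p : K[X]} (hp : p ≠ 0) :
    cauchyPoly (cauchyPoly p) = cauchyPoly p := by
  have h1 := natDegree_cauchyPoly hp
  have h2 := leadingCoeff_cauchyPoly hp
  calc cauchyPoly (cauchyPoly p)
      = C ‖(cauchyPoly p).leadingCoeff‖ * X ^ (cauchyPoly p).natDegree -
          ∑ i ∈ range (cauchyPoly p).natDegree, C ‖(cauchyPoly p).coeff i‖ * X ^ i := rfl
    _ = C ‖p.leadingCoeff‖ * X ^ p.natDegree -
          ∑ i ∈ range p.natDegree, C ‖p.coeff i‖ * X ^ i := by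
        rw [h1, h2, Real.norm_eq_abs, abs_norm]
        simp_rw [norm_coeff_cauchyPoly]
    _ = cauchyPoly p := rfl

/-- Hence `cauchyRadius (cauchyPoly p) = cauchyRadius p` (`p ≠ 0`). [cite: Henrici1974, §6.4 Thm 6.4l (the
Cauchy radius ρ: unique positive zero of the associated polynomial) — idempotence remark, folklore] -/
theorem cauchyRadius_cauchyPoly {p : K[X]} (hp : p ≠ 0) :
    cauchyRadius (cauchyPoly p) = cauchyRadius p := by
  simp only [cauchyRadius, cauchySet, cauchyPoly_cauchyPoly hp]

/-- **Optimality of Cauchy's radius** (Prasolov §1.1.2, remark after Thm 1.1.3; Henrici §6.4.III):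
for `p ≠ 0` of degree `n ≥ 1` there is a (real) polynomial with the same degree and the same
coefficient moduli as `p` having a zero of modulus exactly `cauchyRadius p` — namely `cauchyPoly p`
and its positive root `ρ`. So no bound depending only on `|a₀|, …, |aₙ|` improves on `ρ`.
[cite: Prasolov2004, §1.1.2 Thm 1.1.3; Henrici1974, §6.4 Thm 6.4l] -/
theorem exists_sameModuli_isRoot {p : K[X]} (hp : p ≠ 0) (hn : 0 < p.natDegree) :
    ∃ q : ℝ[X], q.natDegree = p.natDegree ∧ (∀ i, ‖q.coeff i‖ = ‖p.coeff i‖) ∧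
      ∃ x : ℝ, q.IsRoot x ∧ ‖x‖ = cauchyRadius p :=
  ⟨cauchyPoly p, natDegree_cauchyPoly hp, norm_coeff_cauchyPoly p, cauchyRadius p,
    isRoot_cauchyRadius hp hn, by rw [Real.norm_eq_abs, abs_of_nonneg (cauchyRadius_nonneg p)]⟩

end Literature.Algebra.Polynomial.CauchyRadius

end
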